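import Mathlib
import HarnessLib
import Summits.Ventures.LatticeQCDFlow.Scoring.SU3TraceLowerBound

/-!
# The model-free moment envelope of the `SU(3)` plaquette: under ANY law, `E[P] ∈ [−1/2, 1]` and `Var P ≤ (1 − E P)(E P + 1/2) ≤ 9/16`

HONEST FRAMING: exact (Metropolis-corrected) sampling algorithms for lattice gauge theory;
figures of merit are autocorrelation/cost numbers at stated couplings and volumes; no
continuum-physics claim.

Venture `LatticeQCDFlow` (cell pub-lqcd), sub-topic `Scoring`; FANOUT row 21 (`su3-base`; the
boarded plaquette rows of the `SU(3)` baselines, acceptance (a): plaquette vs literature values).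
NEW WORK of the cell (placement rule), elementary: row 21 GEN-8's `Scoring/SU3TraceLowerBound`
(`su3Plaquette_mem_Icc`: `P = (1/3) Re tr U ∈ [−1/2, 1]` for every `U ∈ SU(3)`;
`su3WilsonDensity_mem_Icc`) fed into Mathlib's Bhatia–Davis and Popoviciu variance inequalities.
No definition is introduced; nothing is cited as a fact; no number of ours.

A scorer's sanity envelope for an `SU(3)` plaquette row must hold for EVERY probability law of the
links (the Wilson measure at any `β`, any volume, any boundary condition, and any Markov-chain
marginal along a run, thermalised or not): the plaquette random variable `P = (1/3) Re tr U_p`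
takes values in `[−1/2, 1]` (not `[−1, 1]`), so its mean lies in `[−1/2, 1]`, and its variance obeys
the Bhatia–Davis bound `Var P ≤ (1 − E P)(E P + 1/2)`, at most `9/16` (Popoviciu) — versus
`(1 − E P)(E P + 1)` and `1` from the generic unitary window.  The same for the Wilson density
`s = 3 − Re tr U_p ∈ [0, 9/2]` and for the volume-averaged plaquette.

## What is proved (`μ` a probability measure on any `Ω`, `U : Ω → SU(3)` measurable)

* `su3Plaquette_ae_mem_Icc` — `P ∘ U ∈ [−1/2, 1]` everywhere (hence a.e.);
  **`integral_su3Plaquette_mem_Icc`** — `E[P] ∈ [−1/2, 1]`;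
  **`variance_su3Plaquette_le_bhatiaDavis`** — `Var P ≤ (1 − E P)(E P + 1/2)`;
  **`variance_su3Plaquette_le`** — `Var P ≤ 9/16`.
* `integral_su3WilsonDensity_mem_Icc` (`E[3 − Re tr U] ∈ [0, 9/2]`),
  `variance_su3WilsonDensity_le_bhatiaDavis`, `variance_su3WilsonDensity_le` (`≤ 81/16`).
* `su3PlaquetteAverage_mem_Icc` — the average of finitely many `SU(3)` plaquette variables lies in
  `[−1/2, 1]` pointwise, so the same three bounds hold for the volume-averaged plaquette
  (`variance_su3PlaquetteAverage_le_bhatiaDavis`).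

NOT CLAIMED: any actual value of `E[P]` or `Var P` under the Wilson measure (the row's numbers and
the literature's); independence or correlation structure between plaquettes.
-/

namespace Summit.Ventures.LatticeQCDFlow.Scoring

open MeasureTheory ProbabilityTheory
open Literature.MathematicalPhysics.QuantumLattice

variable {Ω : Type*} [MeasurableSpace Ω] {μ : Measure Ω} [IsProbabilityMeasure μ]

/-! ## §1 The single plaquette -/

omit [IsProbabilityMeasure μ] in
/-- The `SU(3)` plaquette variable lies in `[−1/2, 1]` at every sample point. -/
theorem su3Plaquette_ae_mem_Icc (U : Ω → Matrix.specialUnitaryGroup (Fin 3) ℂ) :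
    ∀ᵐ ω ∂μ, (1 / 3 : ℝ) * ((U ω : Matrix (Fin 3) (Fin 3) ℂ).trace).re ∈ Set.Icc (-(1 / 2 : ℝ)) 1 :=
  ae_of_all μ fun ω => su3Plaquette_mem_Icc (U ω)

/-- Measurability of the plaquette variable along a measurable `SU(3)`-valued map. -/
theorem measurable_su3Plaquette {U : Ω → Matrix.specialUnitaryGroup (Fin 3) ℂ} (hU : Measurable U) :
    Measurable fun ω => (1 / 3 : ℝ) * ((U ω : Matrix (Fin 3) (Fin 3) ℂ).trace).re := by
  have hc : Continuous fun g : Matrix.specialUnitaryGroup (Fin 3) ℂ =>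
      (1 / 3 : ℝ) * ((g : Matrix (Fin 3) (Fin 3) ℂ).trace).re := by
    have h := (continuous_reTr (n := Fin 3))
    exact continuous_const.mul h
  exact hc.measurable.comp hU

/-- **`E[P] ∈ [−1/2, 1]` under every probability law.** -/
theorem integral_su3Plaquette_mem_Icc {U : Ω → Matrix.specialUnitaryGroup (Fin 3) ℂ}
    (hU : Measurable U) :
    ∫ ω, (1 / 3 : ℝ) * ((U ω : Matrix (Fin 3) (Fin 3) ℂ).trace).re ∂μ ∈ Set.Icc (-(1 / 2 : ℝ)) 1 := by
  have hb := su3Plaquette_ae_mem_Icc (μ := μ) U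
  have hint : Integrable (fun ω => (1 / 3 : ℝ) * ((U ω : Matrix (Fin 3) (Fin 3) ℂ).trace).re) μ :=
    (memLp_of_bounded hb (measurable_su3Plaquette hU).aestronglyMeasurable 1).integrable le_rfl
  constructor
  · have h := integral_mono (integrable_const (-(1 / 2 : ℝ))) hint (fun ω => (su3Plaquette_mem_Icc (U ω)).1)
    simpa using h
  · have h := integral_mono hint (integrable_const (1 : ℝ)) (fun ω => (su3Plaquette_mem_Icc (U ω)).2)
    simpa using h

/-- **Bhatia–Davis for the `SU(3)` plaquette**: `Var P ≤ (1 − E P)(E P + 1/2)`. -/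
theorem variance_su3Plaquette_le_bhatiaDavis {U : Ω → Matrix.specialUnitaryGroup (Fin 3) ℂ}
    (hU : Measurable U) :
    variance (fun ω => (1 / 3 : ℝ) * ((U ω : Matrix (Fin 3) (Fin 3) ℂ).trace).re) μ ≤
      (1 - ∫ ω, (1 / 3 : ℝ) * ((U ω : Matrix (Fin 3) (Fin 3) ℂ).trace).re ∂μ) *
        (∫ ω, (1 / 3 : ℝ) * ((U ω : Matrix (Fin 3) (Fin 3) ℂ).trace).re ∂μ - (-(1 / 2 : ℝ))) :=
  variance_le_sub_mul_sub (su3Plaquette_ae_mem_Icc U) (measurable_su3Plaquette hU).aemeasurable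

/-- **Popoviciu for the `SU(3)` plaquette**: `Var P ≤ 9/16` under every probability law (the generic
unitary window `[−1, 1]` would only give `1`). -/
theorem variance_su3Plaquette_le {U : Ω → Matrix.specialUnitaryGroup (Fin 3) ℂ} (hU : Measurable U) :
    variance (fun ω => (1 / 3 : ℝ) * ((U ω : Matrix (Fin 3) (Fin 3) ℂ).trace).re) μ ≤ 9 / 16 := by
  have h := variance_le_sq_of_bounded (su3Plaquette_ae_mem_Icc (μ := μ) U)
    (measurable_su3Plaquette hU).aemeasurable
  norm_num at h
  exact h

/-! ## §2 The Wilson density `3 − Re tr U ∈ [0, 9/2]` -/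

/-- Measurability of the Wilson density along a measurable `SU(3)`-valued map. -/
theorem measurable_su3WilsonDensity {U : Ω → Matrix.specialUnitaryGroup (Fin 3) ℂ}
    (hU : Measurable U) :
    Measurable fun ω => (3 : ℝ) - ((U ω : Matrix (Fin 3) (Fin 3) ℂ).trace).re :=
  measurable_const.sub ((continuous_reTr (n := Fin 3)).measurable.comp hU)

/-- **`E[3 − Re tr U] ∈ [0, 9/2]` under every probability law.** -/
theorem integral_su3WilsonDensity_mem_Icc {U : Ω → Matrix.specialUnitaryGroup (Fin 3) ℂ}
    (hU : Measurable U) :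
    ∫ ω, ((3 : ℝ) - ((U ω : Matrix (Fin 3) (Fin 3) ℂ).trace).re) ∂μ ∈ Set.Icc (0 : ℝ) (9 / 2) := by
  have hb : ∀ᵐ ω ∂μ, (3 : ℝ) - ((U ω : Matrix (Fin 3) (Fin 3) ℂ).trace).re ∈ Set.Icc (0 : ℝ) (9 / 2) :=
    ae_of_all μ fun ω => su3WilsonDensity_mem_Icc (U ω)
  have hint : Integrable (fun ω => (3 : ℝ) - ((U ω : Matrix (Fin 3) (Fin 3) ℂ).trace).re) μ :=
    (memLp_of_bounded hb (measurable_su3WilsonDensity hU).aestronglyMeasurable 1).integrable le_rfl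
  constructor
  · exact integral_nonneg fun ω => (su3WilsonDensity_mem_Icc (U ω)).1
  · have h := integral_mono hint (integrable_const (9 / 2 : ℝ))
      (fun ω => (su3WilsonDensity_mem_Icc (U ω)).2)
    simpa using h

/-- Bhatia–Davis for the Wilson density: `Var s ≤ (9/2 − E s) · E s`. -/
theorem variance_su3WilsonDensity_le_bhatiaDavis {U : Ω → Matrix.specialUnitaryGroup (Fin 3) ℂ}
    (hU : Measurable U) :
    variance (fun ω => (3 : ℝ) - ((U ω : Matrix (Fin 3) (Fin 3) ℂ).trace).re) μ ≤
      (9 / 2 - ∫ ω, ((3 : ℝ) - ((U ω : Matrix (Fin 3) (Fin 3) ℂ).trace).re) ∂μ) *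
        (∫ ω, ((3 : ℝ) - ((U ω : Matrix (Fin 3) (Fin 3) ℂ).trace).re) ∂μ - 0) :=
  variance_le_sub_mul_sub (ae_of_all μ fun ω => su3WilsonDensity_mem_Icc (U ω))
    (measurable_su3WilsonDensity hU).aemeasurable

/-- Popoviciu for the Wilson density: `Var s ≤ 81/16`. -/
theorem variance_su3WilsonDensity_le {U : Ω → Matrix.specialUnitaryGroup (Fin 3) ℂ}
    (hU : Measurable U) :
    variance (fun ω => (3 : ℝ) - ((U ω : Matrix (Fin 3) (Fin 3) ℂ).trace).re) μ ≤ 81 / 16 := by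
  have h := variance_le_sq_of_bounded (ae_of_all μ fun ω => su3WilsonDensity_mem_Icc (U ω))
    (measurable_su3WilsonDensity hU).aemeasurable
  norm_num at h
  exact h

/-! ## §3 The volume-averaged plaquette -/

/-- The average of finitely many `SU(3)` plaquette variables lies in `[−1/2, 1]` pointwise. -/
theorem su3PlaquetteAverage_mem_Icc {ι : Type*} (s : Finset ι) (hs : s.Nonempty)
    (V : ι → Matrix.specialUnitaryGroup (Fin 3) ℂ) :
    (s.card : ℝ)⁻¹ * ∑ p ∈ s, (1 / 3 : ℝ) * ((V p : Matrix (Fin 3) (Fin 3) ℂ).trace).re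
      ∈ Set.Icc (-(1 / 2 : ℝ)) 1 := by
  have hcard : (0 : ℝ) < s.card := by exact_mod_cast hs.card_pos
  constructor
  · have h : ∑ _p ∈ s, (-(1 / 2 : ℝ)) ≤ ∑ p ∈ s, (1 / 3 : ℝ) * ((V p : Matrix (Fin 3) (Fin 3) ℂ).trace).re :=
      Finset.sum_le_sum fun p _ => (su3Plaquette_mem_Icc (V p)).1
    rw [Finset.sum_const, nsmul_eq_mul] at h
    rw [le_inv_mul_iff₀ hcard]
    linarith
  · have h : ∑ p ∈ s, (1 / 3 : ℝ) * ((V p : Matrix (Fin 3) (Fin 3) ℂ).trace).re ≤ ∑ _p ∈ s, (1 : ℝ) :=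
      Finset.sum_le_sum fun p _ => (su3Plaquette_mem_Icc (V p)).2
    rw [Finset.sum_const, nsmul_eq_mul, mul_one] at h
    rw [inv_mul_le_iff₀ hcard]
    linarith

/-- **Bhatia–Davis for the volume-averaged `SU(3)` plaquette** `P̄ = (1/#s) Σ_{p ∈ s} P_p`:
`Var P̄ ≤ (1 − E P̄)(E P̄ + 1/2)` under every probability law of the configuration. -/
theorem variance_su3PlaquetteAverage_le_bhatiaDavis {ι : Type*} (s : Finset ι) (hs : s.Nonempty)
    {V : ι → Ω → Matrix.specialUnitaryGroup (Fin 3) ℂ} (hV : ∀ p, Measurable (V p)) :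
    variance (fun ω => (s.card : ℝ)⁻¹ *
        ∑ p ∈ s, (1 / 3 : ℝ) * ((V p ω : Matrix (Fin 3) (Fin 3) ℂ).trace).re) μ ≤
      (1 - ∫ ω, (s.card : ℝ)⁻¹ *
          ∑ p ∈ s, (1 / 3 : ℝ) * ((V p ω : Matrix (Fin 3) (Fin 3) ℂ).trace).re ∂μ) *
        (∫ ω, (s.card : ℝ)⁻¹ *
          ∑ p ∈ s, (1 / 3 : ℝ) * ((V p ω : Matrix (Fin 3) (Fin 3) ℂ).trace).re ∂μ - (-(1 / 2 : ℝ))) := by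
  refine variance_le_sub_mul_sub (ae_of_all μ fun ω => su3PlaquetteAverage_mem_Icc s hs (fun p => V p ω)) ?_
  refine (measurable_const.mul (Finset.measurable_sum s fun p _ => ?_)).aemeasurable
  exact measurable_su3Plaquette (hV p)

end Summit.Ventures.LatticeQCDFlow.Scoring
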